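import Mathlib
import Summits.ValiantsHypothesis.ValiantsHypothesis.Theorems.ProofCarryingSymmetryRestorationQPConstNorm
import Summits.ValiantsHypothesis.ValiantsHypothesis.Theorems.ProofCarryingSymmetryRestorationQPACReach

/-!
# Route ProofCarryingSymmetry — crux `RestorationQP`, line `registered`, rung S3⁗ under stub S2″ (`stub_proofsToACEquiv`), part 4:
normal forms of the constant-folding normaliser

Continuation of `…RestorationQPConstNorm.lean` (`asplit`, `sadd`, `msplit`, `smul`, `cnorm`).  The
NORMAL FORMS are the formulas all of whose subformulas satisfy the local condition `LocalNF`: at a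
`+` node the left child has no constant among its flattened summands (`APure`) and the right child
is either a NONZERO constant or also `APure`; at a `×` node likewise with `MPure` and a constant
`≠ 0, 1`.  We prove

* the shape trichotomies `NF.ashape` / `NF.mshape` (a normal form is a constant, or pure, or
  `p + c` / `p · c` with `p` pure and `c ≠ 0` / `c ≠ 0, 1`), and the resulting computation rules
  `amk_asplit`, `mmk_msplit`, `asplit_sadd`, `msplit_smul_snd/fst`;
* `nf_sadd`, `nf_smul`, **`nf_cnorm`**: smart sums and products of normal forms, hence all values
  of `cnorm`, are normal forms.

The algebra modulo AC and the key lemma are part 5 (`…ConstNormAC.lean`).  Everything is elementary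
and proved; no named facts.
-/

-- single-problem summit: `Summit.ValiantsHypothesis.ValiantsHypothesis.…` is the namespace by design (D-0017)
set_option linter.dupNamespace false

noncomputable section

open scoped Classical

namespace Summit.ValiantsHypothesis.ValiantsHypothesis.Theorems

namespace ACStability

open Literature.Computability.AlgebraicComplexity ACClass

universe u v

variable {𝔽 : Type u} {X : Type v}

/-! ### Pure formulas: no constant among the flattened summands / factors -/

/-- No flattened summand of `p` is a constant. [folklore] -/
def APure (p : PIFormula 𝔽 X) : Prop := ∀ u ∈ addArgs p, constOf u = none

/-- No flattened factor of `p` is a constant. [folklore] -/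
def MPure (p : PIFormula 𝔽 X) : Prop := ∀ u ∈ mulArgs p, constOf u = none

/-- A variable is additively pure. [folklore] -/
theorem apure_var (x : X) : APure (.var x : PIFormula 𝔽 X) := by simp [APure, addArgs]
/-- A product is additively pure. [folklore] -/
theorem apure_mul (p q : PIFormula 𝔽 X) : APure (.mul p q) := by simp [APure, addArgs]
/-- A constant is not additively pure. [folklore] -/
theorem not_apure_const (c : 𝔽) : ¬ APure (.const c : PIFormula 𝔽 X) := by simp [APure, addArgs]
/-- Purity of a sum. [folklore] -/
theorem apure_add_iff {p q : PIFormula 𝔽 X} : APure (.add p q) ↔ APure p ∧ APure q := by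
  simp only [APure, addArgs_add, List.mem_append]
  exact ⟨fun h => ⟨fun u hu => h u (Or.inl hu), fun u hu => h u (Or.inr hu)⟩,
    fun h u hu => hu.elim (h.1 u) (h.2 u)⟩

/-- A variable is multiplicatively pure. [folklore] -/
theorem mpure_var (x : X) : MPure (.var x : PIFormula 𝔽 X) := by simp [MPure, mulArgs]
/-- A sum is multiplicatively pure. [folklore] -/
theorem mpure_add (p q : PIFormula 𝔽 X) : MPure (.add p q) := by simp [MPure, mulArgs]
/-- A constant is not multiplicatively pure. [folklore] -/
theorem not_mpure_const (c : 𝔽) : ¬ MPure (.const c : PIFormula 𝔽 X) := by simp [MPure, mulArgs]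
/-- Purity of a product. [folklore] -/
theorem mpure_mul_iff {p q : PIFormula 𝔽 X} : MPure (.mul p q) ↔ MPure p ∧ MPure q := by
  simp only [MPure, mulArgs_mul, List.mem_append]
  exact ⟨fun h => ⟨fun u hu => h u (Or.inl hu), fun u hu => h u (Or.inr hu)⟩,
    fun h u hu => hu.elim (h.1 u) (h.2 u)⟩

/-- A pure formula is not a constant. [folklore] -/
theorem APure.constOf_eq {p : PIFormula 𝔽 X} (h : APure p) : constOf p = none := by
  cases p with
  | const c => exact absurd h (not_apure_const c)
  | _ => rfl

/-- A pure formula is not a constant. [folklore] -/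
theorem MPure.constOf_eq {p : PIFormula 𝔽 X} (h : MPure p) : constOf p = none := by
  cases p with
  | const c => exact absurd h (not_mpure_const c)
  | _ => rfl

/-- No flattened summand of a pure formula is AC-equivalent to a constant. [folklore] -/
theorem APure.mk_const_not_mem {p : PIFormula 𝔽 X} (h : APure p) (k : 𝔽) :
    mk (.const k) ∉ (addArgs p).map mk := by
  intro hm
  obtain ⟨u, hu, e⟩ := List.mem_map.1 hm
  have : u = .const k := (mk_eq_mk.1 e.symm).eq_of_const
  have := h u hu
  simp [‹u = _›] at this

/-- No flattened factor of a pure formula is AC-equivalent to a constant. [folklore] -/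
theorem MPure.mk_const_not_mem {p : PIFormula 𝔽 X} (h : MPure p) (k : 𝔽) :
    mk (.const k) ∉ (mulArgs p).map mk := by
  intro hm
  obtain ⟨u, hu, e⟩ := List.mem_map.1 hm
  have : u = .const k := (mk_eq_mk.1 e.symm).eq_of_const
  have := h u hu
  simp [‹u = _›] at this

section NF

variable [CommSemiring 𝔽]

/-- A pure formula splits trivially. [folklore] -/
theorem APure.asplit_eq {p : PIFormula 𝔽 X} (h : APure p) : asplit p = (some p, 0) := by
  cases p with
  | var x => rfl
  | const c => exact absurd h (not_apure_const c)
  | mul p q => rfl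
  | add p q => exact asplit_add_of_ne (apure_add_iff.1 h).2.constOf_eq

/-- A pure formula splits trivially. [folklore] -/
theorem MPure.msplit_eq {p : PIFormula 𝔽 X} (h : MPure p) : msplit p = (some p, 1) := by
  cases p with
  | var x => rfl
  | const c => exact absurd h (not_mpure_const c)
  | add p q => rfl
  | mul p q => exact msplit_mul_of_ne (mpure_mul_iff.1 h).2.constOf_eq

/-! ### Normal forms -/

/-- The local normal-form condition at a node. [folklore] -/
def LocalNF : PIFormula 𝔽 X → Prop
  | .add p q => APure p ∧ ((∃ k, k ≠ 0 ∧ q = .const k) ∨ APure q)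
  | .mul p q => MPure p ∧ ((∃ k, k ≠ 0 ∧ k ≠ 1 ∧ q = .const k) ∨ MPure q)
  | _ => True

/-- Normal forms: every subformula satisfies the local condition. [folklore] -/
def NF (r : PIFormula 𝔽 X) : Prop := ∀ s ∈ subs r, LocalNF s

/-- A variable is a normal form. [folklore] -/
theorem nf_var (x : X) : NF (.var x : PIFormula 𝔽 X) := by
  intro s hs; simp [subs] at hs; subst hs; trivial

/-- A constant is a normal form. [folklore] -/
theorem nf_const (c : 𝔽) : NF (.const c : PIFormula 𝔽 X) := by
  intro s hs; simp [subs] at hs; subst hs; trivial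

/-- Normal forms are closed under subformulas. [folklore] -/
theorem NF.of_mem_subs {r p : PIFormula 𝔽 X} (h : NF r) (hp : p ∈ subs r) : NF p :=
  fun _ hs => h _ (subs_subset_of_mem hp hs)

/-- The root of a normal form satisfies the local condition. [folklore] -/
theorem NF.localNF {r : PIFormula 𝔽 X} (h : NF r) : LocalNF r := h r (mem_subs_self r)

/-- A sum is a normal form iff the root is locally normal and both children are. [folklore] -/
theorem nf_add_iff {p q : PIFormula 𝔽 X} : NF (.add p q) ↔ LocalNF (.add p q) ∧ NF p ∧ NF q := by
  constructor
  · intro h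
    exact ⟨h.localNF, h.of_mem_subs (by simp [subs, mem_subs_self]),
      h.of_mem_subs (by simp [subs, mem_subs_self])⟩
  · rintro ⟨h0, hp, hq⟩ s hs
    simp only [subs, List.mem_cons, List.mem_append] at hs
    rcases hs with rfl | hs | hs
    · exact h0
    · exact hp s hs
    · exact hq s hs

/-- A product is a normal form iff the root is locally normal and both children are. [folklore] -/
theorem nf_mul_iff {p q : PIFormula 𝔽 X} : NF (.mul p q) ↔ LocalNF (.mul p q) ∧ NF p ∧ NF q := by
  constructor
  · intro h
    exact ⟨h.localNF, h.of_mem_subs (by simp [subs, mem_subs_self]),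
      h.of_mem_subs (by simp [subs, mem_subs_self])⟩
  · rintro ⟨h0, hp, hq⟩ s hs
    simp only [subs, List.mem_cons, List.mem_append] at hs
    rcases hs with rfl | hs | hs
    · exact h0
    · exact hp s hs
    · exact hq s hs

/-- **Additive shape of a normal form**: a constant, or pure, or `p + k` with `p` pure and `k ≠ 0`.
[folklore] -/
theorem NF.ashape {a : PIFormula 𝔽 X} (h : NF a) :
    (∃ k, a = .const k) ∨ APure a ∨ (∃ p k, a = .add p (.const k) ∧ k ≠ 0 ∧ APure p) := by
  cases a with
  | var x => exact Or.inr (Or.inl (apure_var x))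
  | const c => exact Or.inl ⟨c, rfl⟩
  | mul p q => exact Or.inr (Or.inl (apure_mul p q))
  | add p q =>
    obtain ⟨hp, ⟨k, hk, rfl⟩ | hq⟩ := h.localNF
    · exact Or.inr (Or.inr ⟨p, k, rfl, hk, hp⟩)
    · exact Or.inr (Or.inl (apure_add_iff.2 ⟨hp, hq⟩))

/-- **Multiplicative shape of a normal form**: a constant, or pure, or `p · k` with `p` pure and
`k ≠ 0, 1`. [folklore] -/
theorem NF.mshape {a : PIFormula 𝔽 X} (h : NF a) :
    (∃ k, a = .const k) ∨ MPure a ∨ (∃ p k, a = .mul p (.const k) ∧ k ≠ 0 ∧ k ≠ 1 ∧ MPure p) := by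
  cases a with
  | var x => exact Or.inr (Or.inl (mpure_var x))
  | const c => exact Or.inl ⟨c, rfl⟩
  | add p q => exact Or.inr (Or.inl (mpure_add p q))
  | mul p q =>
    obtain ⟨hp, ⟨k, hk0, hk1, rfl⟩ | hq⟩ := h.localNF
    · exact Or.inr (Or.inr ⟨p, k, rfl, hk0, hk1, hp⟩)
    · exact Or.inr (Or.inl (mpure_mul_iff.2 ⟨hp, hq⟩))

/-- The non-constant summand of a normal form is a pure normal form. [folklore] -/
theorem NF.asplit_fst {a p : PIFormula 𝔽 X} (h : NF a) (hp : (asplit a).1 = some p) : NF p ∧ APure p := by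
  rcases h.ashape with ⟨k, rfl⟩ | ha | ⟨q, k, rfl, -, hq⟩
  · simp at hp
  · rw [ha.asplit_eq] at hp
    cases hp
    exact ⟨h, ha⟩
  · simp only [asplit_add_const, Option.some.injEq] at hp
    subst hp
    exact ⟨h.of_mem_subs (by simp [subs, mem_subs_self]), hq⟩

/-- The non-constant factor of a normal form is a pure normal form. [folklore] -/
theorem NF.msplit_fst {a p : PIFormula 𝔽 X} (h : NF a) (hp : (msplit a).1 = some p) : NF p ∧ MPure p := by
  rcases h.mshape with ⟨k, rfl⟩ | ha | ⟨q, k, rfl, -, -, hq⟩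
  · simp at hp
  · rw [ha.msplit_eq] at hp
    cases hp
    exact ⟨h, ha⟩
  · simp only [msplit_mul_const, Option.some.injEq] at hp
    subst hp
    exact ⟨h.of_mem_subs (by simp [subs, mem_subs_self]), hq⟩

/-- Reassembling the parts of a normal form gives it back. [folklore] -/
theorem NF.amk_asplit {a : PIFormula 𝔽 X} (h : NF a) : amk (asplit a).1 (asplit a).2 = a := by
  rcases h.ashape with ⟨k, rfl⟩ | ha | ⟨q, k, rfl, hk, -⟩
  · rfl
  · rw [ha.asplit_eq]; exact amk_some_zero a
  · rw [asplit_add_const]; exact amk_some_of_ne q hk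

/-- Reassembling the parts of a normal form gives it back. [folklore] -/
theorem NF.mmk_msplit {a : PIFormula 𝔽 X} (h : NF a) : mmk (msplit a).1 (msplit a).2 = a := by
  rcases h.mshape with ⟨k, rfl⟩ | ha | ⟨q, k, rfl, -, hk1, -⟩
  · rfl
  · rw [ha.msplit_eq]; exact mmk_some_one a
  · rw [msplit_mul_const]; exact mmk_some_of_ne q hk1

/-- The constant factor of a normal form vanishes only for the constant `0` (over `0 ≠ 1`).
[folklore] -/
theorem NF.eq_const_zero_of_msplit [Nontrivial 𝔽] {a : PIFormula 𝔽 X} (h : NF a) (h0 : (msplit a).2 = 0) :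
    a = .const 0 := by
  rcases h.mshape with ⟨k, rfl⟩ | ha | ⟨q, k, rfl, hk0, -, -⟩
  · simp at h0; rw [h0]
  · rw [ha.msplit_eq] at h0; exact absurd h0 one_ne_zero
  · simp at h0; exact absurd h0 hk0

/-! ### Smart sums and products of normal forms -/

/-- Merging pure normal forms gives a pure normal form. [folklore] -/
theorem nf_amerge {x y : Option (PIFormula 𝔽 X)} (hx : ∀ p, x = some p → NF p ∧ APure p)
    (hy : ∀ p, y = some p → NF p ∧ APure p) : ∀ p, amerge x y = some p → NF p ∧ APure p := by
  intro p hp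
  cases x with
  | none => exact hy p hp
  | some q =>
    cases y with
    | none => exact hx p hp
    | some r =>
      simp only [amerge_some_some, Option.some.injEq] at hp
      subst hp
      obtain ⟨hq, hq'⟩ := hx q rfl
      obtain ⟨hr, hr'⟩ := hy r rfl
      exact ⟨nf_add_iff.2 ⟨⟨hq', Or.inr hr'⟩, hq, hr⟩, apure_add_iff.2 ⟨hq', hr'⟩⟩

/-- Merging pure normal forms gives a pure normal form. [folklore] -/
theorem nf_mmerge {x y : Option (PIFormula 𝔽 X)} (hx : ∀ p, x = some p → NF p ∧ MPure p)
    (hy : ∀ p, y = some p → NF p ∧ MPure p) : ∀ p, mmerge x y = some p → NF p ∧ MPure p := by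
  intro p hp
  cases x with
  | none => exact hy p hp
  | some q =>
    cases y with
    | none => exact hx p hp
    | some r =>
      simp only [mmerge_some_some, Option.some.injEq] at hp
      subst hp
      obtain ⟨hq, hq'⟩ := hx q rfl
      obtain ⟨hr, hr'⟩ := hy r rfl
      exact ⟨nf_mul_iff.2 ⟨⟨hq', Or.inr hr'⟩, hq, hr⟩, mpure_mul_iff.2 ⟨hq', hr'⟩⟩

/-- Reassembling a pure normal form and a constant gives a normal form. [folklore] -/
theorem nf_amk {m : Option (PIFormula 𝔽 X)} (hm : ∀ p, m = some p → NF p ∧ APure p) (c : 𝔽) :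
    NF (amk m c) := by
  cases m with
  | none => exact nf_const c
  | some p =>
    obtain ⟨hp, hp'⟩ := hm p rfl
    by_cases hc : c = 0
    · subst hc; rw [amk_some_zero]; exact hp
    · rw [amk_some_of_ne p hc]
      exact nf_add_iff.2 ⟨⟨hp', Or.inl ⟨c, hc, rfl⟩⟩, hp, nf_const c⟩

/-- Reassembling a pure normal form and a nonzero constant gives a normal form. [folklore] -/
theorem nf_mmk {m : Option (PIFormula 𝔽 X)} (hm : ∀ p, m = some p → NF p ∧ MPure p) {c : 𝔽}
    (hc0 : c ≠ 0) : NF (mmk m c) := by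
  cases m with
  | none => exact nf_const c
  | some p =>
    obtain ⟨hp, hp'⟩ := hm p rfl
    by_cases hc : c = 1
    · subst hc; rw [mmk_some_one]; exact hp
    · rw [mmk_some_of_ne p hc]
      exact nf_mul_iff.2 ⟨⟨hp', Or.inl ⟨c, hc0, hc, rfl⟩⟩, hp, nf_const c⟩

/-- **Smart sums of normal forms are normal forms.** [folklore] -/
theorem nf_sadd {a b : PIFormula 𝔽 X} (ha : NF a) (hb : NF b) : NF (sadd a b) :=
  nf_amk (nf_amerge (fun _ => ha.asplit_fst) (fun _ => hb.asplit_fst)) _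

/-- **Smart products of normal forms are normal forms.** [folklore] -/
theorem nf_smul {a b : PIFormula 𝔽 X} (ha : NF a) (hb : NF b) : NF (smul a b) := by
  by_cases h : (msplit a).2 * (msplit b).2 = 0
  · rw [smul_of_eq_zero h]; exact nf_const 0
  · rw [smul_of_ne_zero h]
    exact nf_mmk (nf_mmerge (fun _ => ha.msplit_fst) (fun _ => hb.msplit_fst)) h

/-- **Every value of the normaliser is a normal form.** [folklore] -/
theorem nf_cnorm (F : PIFormula 𝔽 X) : NF (cnorm F) := by
  induction F with
  | var x => exact nf_var x
  | const c => exact nf_const c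
  | add F G ihF ihG => exact nf_sadd ihF ihG
  | mul F G ihF ihG => exact nf_smul ihF ihG

/-! ### Computation rules on normal forms -/

/-- A pure optional part splits trivially after reassembling. [folklore] -/
theorem asplit_amk {m : Option (PIFormula 𝔽 X)} (hm : ∀ p, m = some p → NF p ∧ APure p) (c : 𝔽) :
    asplit (amk m c) = (m, c) := by
  cases m with
  | none => rfl
  | some p =>
    by_cases hc : c = 0
    · subst hc; rw [amk_some_zero]; exact (hm p rfl).2.asplit_eq
    · rw [amk_some_of_ne p hc]; rfl

/-- A pure optional part splits trivially after reassembling. [folklore] -/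
theorem msplit_mmk {m : Option (PIFormula 𝔽 X)} (hm : ∀ p, m = some p → NF p ∧ MPure p) (c : 𝔽) :
    msplit (mmk m c) = (m, c) := by
  cases m with
  | none => rfl
  | some p =>
    by_cases hc : c = 1
    · subst hc; rw [mmk_some_one]; exact (hm p rfl).2.msplit_eq
    · rw [mmk_some_of_ne p hc]; rfl

/-- **The parts of a smart sum of normal forms.** [folklore] -/
theorem asplit_sadd {a b : PIFormula 𝔽 X} (ha : NF a) (hb : NF b) :
    asplit (sadd a b) = (amerge (asplit a).1 (asplit b).1, (asplit a).2 + (asplit b).2) :=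
  asplit_amk (nf_amerge (fun _ => ha.asplit_fst) (fun _ => hb.asplit_fst)) _

/-- **The constant of a smart product of normal forms.** [folklore] -/
theorem msplit_smul_snd {a b : PIFormula 𝔽 X} (ha : NF a) (hb : NF b) :
    (msplit (smul a b)).2 = (msplit a).2 * (msplit b).2 := by
  by_cases h : (msplit a).2 * (msplit b).2 = 0
  · rw [smul_of_eq_zero h, h]; rfl
  · rw [smul_of_ne_zero h, msplit_mmk (nf_mmerge (fun _ => ha.msplit_fst) (fun _ => hb.msplit_fst))]

/-- **The non-constant factor of a smart product of normal forms.** [folklore] -/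
theorem msplit_smul_fst {a b : PIFormula 𝔽 X} (ha : NF a) (hb : NF b)
    (h : (msplit a).2 * (msplit b).2 ≠ 0) :
    (msplit (smul a b)).1 = mmerge (msplit a).1 (msplit b).1 := by
  rw [smul_of_ne_zero h, msplit_mmk (nf_mmerge (fun _ => ha.msplit_fst) (fun _ => hb.msplit_fst))]

end NF

end ACStability

open Literature.Computability.AlgebraicComplexity in
/-- **The normaliser produces normal forms** (helper under stub S2″ `stub_proofsToACEquiv`, crux
`RestorationQP`, rung S3⁗): every subformula of `cnorm F` satisfies the local normal-form condition
(constants only as nonzero right children of the root of a maximal sum, constants `≠ 0, 1` only as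
right children of the root of a maximal product). [folklore] -/
theorem proofsToACEquiv_aux_constNormNF : ∀ (n : ℕ) (F : PIFormula ℂ (Fin n × Fin n)), ACStability.NF (ACStability.cnorm F) := by
  intro n F
  exact ACStability.nf_cnorm F

end Summit.ValiantsHypothesis.ValiantsHypothesis.Theorems

end
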